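import Mathlib
import Summits.Ventures.PercRepro2.UniversalAlignedDefs

/-! # The level-aligned package under parallel composition, I: the coordinate assignment and the relays `α k`
(seat mine-b, cell pub-perc-repro2; MINE-B.md §29.3)

Packages `P` on `X` and `Q` on `Y` give a package on the parallel product `X ∗ Y` (labels: sums); this file
has the assignment and the relays `α k`, UniversalAlignedPar.lean the relays `β k` and the package.

* the assignment is the coordinate assignment `parAssign` of UniversalClosures.lean: the slot `i < b x` of
  a product source `(x, y)` goes to `(f (x, i), y)`, the slot `b x + j` to `(x, g (y, j))`;
* the level relay `α k` at `(u, v)` with `b u + b' v > k`: if `b u ≤ k`, move the second coordinate by the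
  level `k − b u` relay of `Y` (the slots of `(u, y)` of index `< k` with a `Y`-part have `Y`-index
  `< k − b u`); if `b u > k` and `r' v ≥ 1`, fix; if `b u > k` and `r' v = 0`, move the first coordinate
  by `α k` of `X`.  The three families are separated by the first coordinate's blue label (`≤ k` / `> k`)
  and the second coordinate's red label (`≥ 1` / `0`). -/

namespace Summit.Ventures.PercRepro2.UHClosure

open Finset

variable {X Y : Type*} [Preorder X] [Preorder Y] [Fintype X] [Fintype Y]
variable {r b : X → ℕ} {r' b' : Y → ℕ} (P : PackageL r b) (Q : PackageL r' b')

/-! ### The coordinate assignment -/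

omit [Preorder X] [Preorder Y] in
/-- the source of `slotX` -/
@[simp] lemma slotX_src (q : SlotL (USrc (parR r r') (parB b b')) (parB b b')) (hi : q.1.2.val < b q.1.1.1.1) :
    (slotX r b r' b' q hi).1.1.1 = q.1.1.1.1 := rfl

omit [Preorder X] [Preorder Y] in
/-- the index of `slotX` -/
@[simp] lemma slotX_idx (q : SlotL (USrc (parR r r') (parB b b')) (parB b b')) (hi : q.1.2.val < b q.1.1.1.1) :
    (slotX r b r' b' q hi).1.2.val = q.1.2.val := rfl

omit [Preorder X] [Preorder Y] in
/-- the source of `slotY` -/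
@[simp] lemma slotY_src (q : SlotL (USrc (parR r r') (parB b b')) (parB b b'))
    (hi : ¬ q.1.2.val < b q.1.1.1.1) : (slotY r b r' b' q hi).1.1.1 = q.1.1.1.2 := rfl

omit [Preorder X] [Preorder Y] in
/-- the index of `slotY` -/
@[simp] lemma slotY_idx (q : SlotL (USrc (parR r r') (parB b b')) (parB b b'))
    (hi : ¬ q.1.2.val < b q.1.1.1.1) : (slotY r b r' b' q hi).1.2.val = q.1.2.val - b q.1.1.1.1 := rfl

omit [Preorder X] [Preorder Y] in
/-- the index of a product slot is below the sum of the blue labels -/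
lemma par_idx_lt (q : SlotL (USrc (parR r r') (parB b b')) (parB b b')) :
    q.1.2.val < b q.1.1.1.1 + b' q.1.1.1.2 := by
  have := q.2; simp only [parB] at this; exact this

/-- **the coordinate assignment is injective** (the two kinds have red patterns `(1, 0)` and `(0, 1)`) -/
theorem parAssign_inj : Function.Injective (parAssign r b r' b' P.f Q.f) := by
  intro q q' hqq'
  unfold parAssign at hqq'
  by_cases hi : q.1.2.val < b q.1.1.1.1 <;> by_cases hi' : q'.1.2.val < b q'.1.1.1.1
  · rw [dif_pos hi, dif_pos hi'] at hqq'
    obtain ⟨h1, h2⟩ := Prod.mk.inj hqq'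
    have h3 := P.f_inj h1
    have hx : q.1.1.1.1 = q'.1.1.1.1 := congrArg (fun s : SlotL (USrc r b) b => s.1.1.1) h3
    have hidx : q.1.2.val = q'.1.2.val := congrArg (fun s : SlotL (USrc r b) b => s.1.2.val) h3
    exact slot_ext q q' (Prod.ext hx h2) hidx
  · rw [dif_pos hi, dif_neg hi'] at hqq'
    exfalso
    obtain ⟨h1, -⟩ := Prod.mk.inj hqq'
    have hr1 := (P.f_spec (slotX r b r' b' q hi)).2.1
    have hr0 := src_fst r b r' b' q'.1.1.2.1
    rw [h1] at hr1; omega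
  · rw [dif_neg hi, dif_pos hi'] at hqq'
    exfalso
    obtain ⟨h1, -⟩ := Prod.mk.inj hqq'
    have hr1 := (P.f_spec (slotX r b r' b' q' hi')).2.1
    have hr0 := src_fst r b r' b' q.1.1.2.1
    rw [← h1] at hr1; omega
  · rw [dif_neg hi, dif_neg hi'] at hqq'
    obtain ⟨h1, h2⟩ := Prod.mk.inj hqq'
    have h3 := Q.f_inj h2
    have hy : q.1.1.1.2 = q'.1.1.1.2 := congrArg (fun s : SlotL (USrc r' b') b' => s.1.1.1) h3
    have hidx : q.1.2.val - b q.1.1.1.1 = q'.1.2.val - b q'.1.1.1.1 :=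
      congrArg (fun s : SlotL (USrc r' b') b' => s.1.2.val) h3
    exact slot_ext q q' (Prod.ext h1 hy) (by rw [h1] at hi hidx; omega)

/-- **the coordinate assignment is a (UH*) assignment** -/
theorem parAssign_spec (q : SlotL (USrc (parR r r') (parB b b')) (parB b b')) :
    parAssign r b r' b' P.f Q.f q ≤ q.1.1.1 ∧ parR r r' (parAssign r b r' b' P.f Q.f q) = 1 ∧
      parB b b' q.1.1.1 ≤ parB b b' (parAssign r b r' b' P.f Q.f q) + 1 := by
  unfold parAssign
  by_cases hi : q.1.2.val < b q.1.1.1.1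
  · rw [dif_pos hi]
    obtain ⟨hle, hr, hb⟩ := P.f_spec (slotX r b r' b' q hi)
    refine ⟨Prod.mk_le_mk.2 ⟨hle, le_rfl⟩, ?_, ?_⟩
    · simp only [parR]; rw [hr, src_snd r b r' b' q.1.1.2.1]
    · rw [slotX_src] at hb; simp only [parB]; omega
  · rw [dif_neg hi]
    obtain ⟨hle, hr, hb⟩ := Q.f_spec (slotY r b r' b' q hi)
    refine ⟨Prod.mk_le_mk.2 ⟨le_rfl, hle⟩, ?_, ?_⟩
    · simp only [parR]; rw [hr, src_fst r b r' b' q.1.1.2.1]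
    · rw [slotY_src] at hb; simp only [parB]; omega

/-! ### The level relays `α k` of the product -/

/-- the level relay `α k` of the parallel product (the three-family rule) -/
def parAlpha (k : ℕ) (z : X × Y) : X × Y :=
  if b z.1 ≤ k then (z.1, Q.α (k - b z.1) z.2)
  else if 1 ≤ r' z.2 then z
  else (P.α k z.1, z.2)

/-- the three families of `parAlpha` -/
lemma parAlpha_cases (k : ℕ) (z : X × Y) :
    (b z.1 ≤ k ∧ parAlpha P Q k z = (z.1, Q.α (k - b z.1) z.2)) ∨
    (¬ b z.1 ≤ k ∧ 1 ≤ r' z.2 ∧ parAlpha P Q k z = z) ∨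
    (¬ b z.1 ≤ k ∧ ¬ 1 ≤ r' z.2 ∧ parAlpha P Q k z = (P.α k z.1, z.2)) := by
  unfold parAlpha
  by_cases h1 : b z.1 ≤ k
  · left; exact ⟨h1, if_pos h1⟩
  · by_cases h2 : 1 ≤ r' z.2
    · right; left; exact ⟨h1, h2, by rw [if_neg h1, if_pos h2]⟩
    · right; right; exact ⟨h1, h2, by rw [if_neg h1, if_neg h2]⟩

omit [Preorder X] [Preorder Y] [Fintype X] [Fintype Y] in
/-- a blue label `> k` of the product -/
lemma parB_gt {k : ℕ} {z : X × Y} (h : k < parB b b' z) : k < b z.1 + b' z.2 := by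
  simp only [parB] at h; exact h

/-- `parAlpha k` is injective on `{b > k}` -/
theorem parAlpha_inj (k : ℕ) (z z' : X × Y) (hz : k < parB b b' z) (hz' : k < parB b b' z')
    (h : parAlpha P Q k z = parAlpha P Q k z') : z = z' := by
  have hz := parB_gt hz
  have hz' := parB_gt hz'
  rcases parAlpha_cases P Q k z with ⟨h1, e⟩ | ⟨h1, h2, e⟩ | ⟨h1, h2, e⟩ <;>
  rcases parAlpha_cases P Q k z' with ⟨h1', e'⟩ | ⟨h1', h2', e'⟩ | ⟨h1', h2', e'⟩ <;>
  rw [e, e'] at h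
  · -- (slab, slab)
    obtain ⟨e1, e2⟩ := Prod.mk.inj h
    rw [← e1] at e2
    exact Prod.ext e1 (Q.α_inj (k - b z.1) z.2 z'.2 (by omega) (by rw [e1]; omega) e2)
  · -- (slab, fixed): the first coordinate has blue `≤ k` and `> k`
    exfalso
    have e1 : z.1 = z'.1 := (Prod.mk.inj h).1
    rw [e1] at h1; exact h1' h1
  · -- (slab, moved): the second coordinate has red `≥ 1` and `0`
    exfalso
    have e2 : Q.α (k - b z.1) z.2 = z'.2 := (Prod.mk.inj h).2
    have := (Q.α_spec (k - b z.1) z.2 (by omega)).2.1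
    rw [e2] at this; exact h2' this
  · exfalso
    have e1 : z.1 = z'.1 := (Prod.mk.inj h).1
    rw [← e1] at h1'; exact h1 h1'
  · exact h
  · exfalso
    have e2 : z.2 = z'.2 := (Prod.mk.inj h).2
    rw [e2] at h2; exact h2' h2
  · exfalso
    have e2 : z.2 = Q.α (k - b z'.1) z'.2 := (Prod.mk.inj h).2
    have := (Q.α_spec (k - b z'.1) z'.2 (by omega)).2.1
    rw [← e2] at this; exact h2 this
  · exfalso
    have e2 : z.2 = z'.2 := (Prod.mk.inj h).2
    rw [← e2] at h2'; exact h2 h2'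
  · -- (moved, moved)
    obtain ⟨e1, e2⟩ := Prod.mk.inj h
    exact Prod.ext (P.α_inj k z.1 z'.1 (by omega) (by omega) e1) e2

/-- `parAlpha k` is downward, red `≥ 1`, blue drop `≤ 1` -/
theorem parAlpha_spec (k : ℕ) (z : X × Y) (hz : k < parB b b' z) :
    parAlpha P Q k z ≤ z ∧ 1 ≤ parR r r' (parAlpha P Q k z) ∧ parB b b' z ≤ parB b b' (parAlpha P Q k z) + 1 := by
  have hz := parB_gt hz
  rcases parAlpha_cases P Q k z with ⟨h1, e⟩ | ⟨h1, h2, e⟩ | ⟨h1, h2, e⟩ <;> rw [e]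
  · obtain ⟨l2, r2, d2⟩ := Q.α_spec (k - b z.1) z.2 (by omega)
    refine ⟨Prod.mk_le_mk.2 ⟨le_rfl, l2⟩, ?_, ?_⟩
    · simp only [parR]; omega
    · simp only [parB]; omega
  · exact ⟨le_rfl, by simp only [parR]; omega, by simp only [parB]; omega⟩
  · obtain ⟨l1, r1, d1⟩ := P.α_spec k z.1 (by omega)
    refine ⟨Prod.mk_le_mk.2 ⟨l1, le_rfl⟩, ?_, ?_⟩
    · simp only [parR]; omega
    · simp only [parB]; omega

/-- `parAlpha k` avoids the images of the slots of index `< k` -/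
theorem parAlpha_avoid (k : ℕ) (z : X × Y) (hz : k < parB b b' z)
    (p : SlotL (USrc (parR r r') (parB b b')) (parB b b')) (hp : p.1.2.val < k) :
    parAlpha P Q k z ≠ parAssign r b r' b' P.f Q.f p := by
  intro he
  have hz := parB_gt hz
  have hx0 := src_fst r b r' b' p.1.1.2.1
  have hy0 := src_snd r b r' b' p.1.1.2.1
  unfold parAssign at he
  rcases parAlpha_cases P Q k z with ⟨h1, e⟩ | ⟨h1, h2, e⟩ | ⟨h1, h2, e⟩ <;> rw [e] at he <;>
  by_cases hi : p.1.2.val < b p.1.1.1.1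
  · -- slab vs an `X`-slot: the second coordinate has red `≥ 1` and `0`
    rw [dif_pos hi] at he
    obtain ⟨-, e2⟩ := Prod.mk.inj he
    have := (Q.α_spec (k - b z.1) z.2 (by omega)).2.1
    rw [e2] at this; omega
  · -- slab vs a `Y`-slot: the `Y`-index is `< k − b u`
    rw [dif_neg hi] at he
    obtain ⟨e1, e2⟩ := Prod.mk.inj he
    have hb : b p.1.1.1.1 = b z.1 := by rw [e1]
    refine Q.α_avoid (k - b z.1) z.2 (by omega) (slotY r b r' b' p hi) ?_ e2
    rw [slotY_idx]; omega
  · -- fixed vs an `X`-slot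
    rw [dif_pos hi] at he
    obtain ⟨-, e2⟩ := Prod.mk.inj he
    rw [e2] at h2; omega
  · -- fixed vs a `Y`-slot: the index is `≥ b u > k`
    rw [dif_neg hi] at he
    obtain ⟨e1, -⟩ := Prod.mk.inj he
    have hb : b p.1.1.1.1 = b z.1 := by rw [e1]
    omega
  · -- moved vs an `X`-slot: `α k` avoids the slots of index `< k`
    rw [dif_pos hi] at he
    obtain ⟨e1, -⟩ := Prod.mk.inj he
    exact P.α_avoid k z.1 (by omega) (slotX r b r' b' p hi) (by rw [slotX_idx]; exact hp) e1
  · -- moved vs a `Y`-slot: the second coordinate has red `0` and `1`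
    rw [dif_neg hi] at he
    obtain ⟨-, e2⟩ := Prod.mk.inj he
    have := (Q.f_spec (slotY r b r' b' p hi)).2.1
    rw [← e2] at this; omega

/-- `parAlpha 0` agrees with the assignment on the slot `0` of every source -/
theorem parAlpha_src (p : SlotL (USrc (parR r r') (parB b b')) (parB b b')) (hp : p.1.2.val = 0) :
    parAlpha P Q 0 p.1.1.1 = parAssign r b r' b' P.f Q.f p := by
  have hx0 := src_fst r b r' b' p.1.1.2.1
  have hy0 := src_snd r b r' b' p.1.1.2.1
  unfold parAssign parAlpha
  by_cases hi : p.1.2.val < b p.1.1.1.1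
  · rw [dif_pos hi, if_neg (by omega), if_neg (by omega)]
    have e : P.α 0 p.1.1.1.1 = P.f (slotX r b r' b' p hi) :=
      P.α_src (slotX r b r' b' p hi) (by rw [slotX_idx]; exact hp)
    rw [e]
  · rw [dif_neg hi, if_pos (by omega)]
    have e : Q.α 0 p.1.1.1.2 = Q.f (slotY r b r' b' p hi) :=
      Q.α_src (slotY r b r' b' p hi) (by rw [slotY_idx]; omega)
    rw [Nat.zero_sub, e]

end Summit.Ventures.PercRepro2.UHClosure
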